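import Mathlib
import Literature.Analysis.FluidPDE.HardSphereCollisionRecord
import HarnessLib

/-!
# `KickFairRelEquilibriumMeso`, line `Sketch` — glue T, part (a): the enumeration `nthTimeAfter`
# lists `S ∩ (a, b]` in increasing order, for EVERY set `S`

Helper file (`--supports stmt-AtomisticToContinuum-15177`) of the line lead for the registered glue stub
`stub_pinchTransfer`. The crux sums its kicks over `n ∈ Finset.range cnt`, `cnt = ncard (T ∩ Ioc 0 τ)`
with `T` the collision times of a sphere along the orbit, and reads the `n`-th kick at the enumerated
time `nthTimeAfter T 0 n`; the glue tiles `(0, τ]` into kinetic windows and needs, for EVERY initial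
datum (good or not, no local finiteness assumed), that the first `cnt` enumerated times are exactly
the elements of `T ∩ (0, τ]`, in increasing order — in particular they lie in `(0, τ]`, so that the
window indicators of a partition of `(0, τ]` sum to `1` on each of them and the crux's `S` is the sum
of its windowed pieces pointwise.

* `nthTimeAfter_eq_orderEmbOfFin` — if `S ∩ (a, b]` is finite, then for `n < #(S ∩ (a, b])` the `n`-th
  enumerated time after `a` is the `n`-th element of `S ∩ (a, b]` in increasing order (elements of `S`
  beyond `b` are larger than all of them, so the `sInf`-recursion never sees them before step `#`);
* `nthTimeAfter_mem_of_lt_ncard` — hence `nthTimeAfter S a n ∈ S ∩ (a, b]` for `n < ncard (S ∩ (a, b])`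
  (no finiteness hypothesis: an infinite intersection has `ncard = 0`);
* `strictMonoOn_nthTimeAfter_of_ncard` — and the enumeration is strictly increasing on `{n | n < ncard}`.
-/

noncomputable section

open Set

namespace Summit.AtomisticToContinuum.HydrodynamicLimit.Theorems.KickFairRelEquilibriumMesoLine

open Literature.Analysis.FluidPDE

/-- **The `sInf`-enumeration lists a finite window in increasing order.** If `S ∩ (a, b]` is finite then for
every `n < #(S ∩ (a, b])` the `n`-th enumerated element of `S` after `a` is the `n`-th smallest element of
`S ∩ (a, b]`. [folklore] -/
theorem nthTimeAfter_eq_orderEmbOfFin {S : Set ℝ} {a b : ℝ} (hfin : (S ∩ Ioc a b).Finite) {n : ℕ}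
    (hn : n < hfin.toFinset.card) :
    nthTimeAfter S a n = hfin.toFinset.orderEmbOfFin rfl ⟨n, hn⟩ := by
  set F := hfin.toFinset with hF
  set e := F.orderEmbOfFin rfl with he
  have hmem : ∀ j : Fin F.card, (e j : ℝ) ∈ S ∩ Ioc a b := fun j =>
    (Set.Finite.mem_toFinset hfin).1 (F.orderEmbOfFin_mem rfl j)
  -- every element of `S` after `e j` (or after `a`) that is `≤ b` is some `e j'`
  have hsurj : ∀ s ∈ S ∩ Ioc a b, ∃ j : Fin F.card, (e j : ℝ) = s := fun s hs => by
    have hsF : s ∈ F := (Set.Finite.mem_toFinset hfin).2 hs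
    have : s ∈ Set.range e := by
      rw [he, Finset.range_orderEmbOfFin]; exact hsF
    obtain ⟨j, hj⟩ := this
    exact ⟨j, hj⟩
  suffices key : ∀ m (hm : m < F.card), nthTimeAfter S a m = e ⟨m, hm⟩ from key n hn
  intro m
  induction m with
  | zero =>
    intro hm
    -- the first enumerated time is the least element of `S ∩ (a, ∞)`, which is `e 0`
    have hleast : IsLeast (S ∩ Ioi a) (e ⟨0, hm⟩) := by
      refine ⟨⟨(hmem _).1, (hmem _).2.1⟩, fun s hs => ?_⟩
      rcases le_or_gt s b with hsb | hbs
      · obtain ⟨j, rfl⟩ := hsurj s ⟨hs.1, hs.2, hsb⟩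
        exact e.monotone (Fin.mk_le_mk.2 (Nat.zero_le _))
      · exact ((hmem _).2.2.trans hbs.le)
    rw [nthTimeAfter_zero, nextTimeAfter, hleast.csInf_eq]
  | succ k ih =>
    intro hm
    have hk : k < F.card := Nat.lt_of_succ_lt hm
    have ihk := ih hk
    have hleast : IsLeast (S ∩ Ioi (nthTimeAfter S a k)) (e ⟨k + 1, hm⟩) := by
      rw [ihk]
      refine ⟨⟨(hmem _).1, ?_⟩, fun s hs => ?_⟩
      · exact e.strictMono (Fin.mk_lt_mk.2 (Nat.lt_succ_self k))
      · rcases le_or_gt s b with hsb | hbs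
        · obtain ⟨j, rfl⟩ := hsurj s ⟨hs.1, ((hmem _).2.1).trans hs.2, hsb⟩
          have hkj : (⟨k, hk⟩ : Fin F.card) < j := e.lt_iff_lt.1 hs.2
          exact e.monotone (Fin.mk_le_mk.2 (Nat.succ_le_of_lt (Fin.mk_lt_mk.1 hkj)))
        · exact ((hmem _).2.2.trans hbs.le)
    rw [nthTimeAfter_succ, nextTimeAfter, hleast.csInf_eq]

/-- **For `n < ncard (S ∩ (a, b])` the `n`-th enumerated time after `a` lies in `S ∩ (a, b]`** — for EVERY
set `S` (if the window is infinite its `ncard` is `0` and there is nothing to prove). [folklore] -/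
theorem nthTimeAfter_mem_of_lt_ncard {S : Set ℝ} {a b : ℝ} {n : ℕ} (hn : n < (S ∩ Ioc a b).ncard) :
    nthTimeAfter S a n ∈ S ∩ Ioc a b := by
  have hfin : (S ∩ Ioc a b).Finite := Set.finite_of_ncard_pos (Nat.zero_lt_of_lt hn)
  have hn' : n < hfin.toFinset.card := by rwa [← Set.ncard_eq_toFinset_card _ hfin]
  rw [nthTimeAfter_eq_orderEmbOfFin hfin hn']
  exact (Set.Finite.mem_toFinset hfin).1 (hfin.toFinset.orderEmbOfFin_mem rfl _)

/-- The enumeration is strictly increasing below `ncard (S ∩ (a, b])`. [folklore] -/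
theorem strictMonoOn_nthTimeAfter_of_ncard {S : Set ℝ} {a b : ℝ} :
    StrictMonoOn (nthTimeAfter S a) {n | n < (S ∩ Ioc a b).ncard} := by
  intro i hi j hj hij
  have hfin : (S ∩ Ioc a b).Finite := Set.finite_of_ncard_pos (Nat.zero_lt_of_lt hj)
  have hc : (S ∩ Ioc a b).ncard = hfin.toFinset.card := Set.ncard_eq_toFinset_card _ hfin
  have hi' : i < hfin.toFinset.card := hc ▸ hi
  have hj' : j < hfin.toFinset.card := hc ▸ hj
  rw [nthTimeAfter_eq_orderEmbOfFin hfin hi', nthTimeAfter_eq_orderEmbOfFin hfin hj']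
  exact (hfin.toFinset.orderEmbOfFin rfl).strictMono (Fin.mk_lt_mk.2 hij)

/-- **Registered sub-goal `transferEnum` of the glue (T-a)**: for every set `S` of reals, origin `a`,
end `b` and `n < ncard (S ∩ (a, b])`, the `n`-th enumerated time after `a` lies in `S ∩ (a, b]` — in
the crux: for `n < cnt` the `n`-th collision time of a sphere is a genuine collision time in `(0, τ]`,
whatever the initial datum. [folklore] -/
theorem transferEnum : ∀ (S : Set ℝ) (a b : ℝ) (n : ℕ), n < (S ∩ Set.Ioc a b).ncard →
    nthTimeAfter S a n ∈ S ∩ Set.Ioc a b :=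
  fun _ _ _ _ hn => nthTimeAfter_mem_of_lt_ncard hn

end Summit.AtomisticToContinuum.HydrodynamicLimit.Theorems.KickFairRelEquilibriumMesoLine

end
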